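import Summits.Langlands.Langlands.Theses.SenNullAlignment
import HarnessLib

/-!
# Birth skeleton (BC3) for the piece `OffPlaneReciprocityA` of the BC2 redirect of
# `SenNullAlignment.SectorComplement` (stmt-Langlands-16308) — line `birth_OffPlaneReciprocityA`

The piece is direction (A) of the summit OFF the odd-Hilbert plane, in rigid pair form, for every pinned datum.
It is cut along its three classical seams:
* `stub_offPlaneAvatar` (W⁺_off, OPEN: Buzzard–Gee Conj. 3.2.2 weak form + irreducibility; theorem-level for regular
  algebraic π over CM / totally real F — Harris–Lan–Taylor–Thorne, Scholze, with de Rham (A'Campo 2024) and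
  irreducibility in low rank / density one; nothing for Maass-type π or general F): an irreducible pinned-geometric
  avatar Satake–Frobenius compatible a.e. EXISTS for every L-algebraic cuspidal π off the plane;
* `stub_offPlanePairCompatibility` (LGC_off, OPEN: Taylor 2004 Conj. 7 for irreducible geometric Satake-compatible
  pairs, every finite place, every Henniart-normalised datum; known: regular conjugate self-dual over CM —
  Harris–Taylor, Taylor–Yoshida, Caraiani; v ∤ ℓ up to N — Varma 2024);
* `stub_avatarConjugacy` (U, a THEOREM: Chebotarev + Brauer–Nesbitt + irreducibility transfer; VERBATIM item
  stmt-Langlands-17844, landed as `ReciprocityUpToIrreducibility.isConjugate_of_satakeFrobCompatibleAt` modulo the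
  import-cone guardrail recorded on that item).
`OffPlaneReciprocityA_of` assembles them (existence half from W⁺_off; pair half: LGC_off and U).

Shape (for `ledger skeleton check`): named stubs `theorem stub_<name> : <Prop> := by sorry` (the ONLY sorries),
`_Goal.stub_<name> : Prop := type_of% @stub_<name>`, and `OffPlaneReciprocityA_of (h₁ : _Goal.stub_…) … : OffPlaneReciprocityA` concluding
the piece BY NAME (real proof); the last `example` feeds the stubs to it.  PRE-SPLIT VERSION: the piece is not yet a
decl of the route file, so it is declared here, VERBATIM the text filed in children.json, inside the route namespace;
after `route edit --split` lands it, delete section `0` and this file refers to the route decl unchanged.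
-/

noncomputable section

set_option linter.dupNamespace false

/-! ## 0. The piece, verbatim (pre-split stand-in for the route decl) -/

namespace Summit.Langlands.Langlands.Theses.SenNullAlignment

open scoped BigOperators Topology Manifold Classical MeasureTheory ProbabilityTheory Matrix InnerProductSpace ComplexConjugate ContinuousMap
open Filter Set Function TopologicalSpace MeasureTheory

/-- **P1 — direction (A) off the odd-Hilbert plane, rigid pair form, ∀ Rec** (children.json text, verbatim). -/
def OffPlaneReciprocityA : Prop :=
  ∀ (K : Type) [Field K] [NumberField K] (Rec : Summit.Langlands.ReciprocityData K) (n : ℕ) (hcpt : Literature.NumberTheory.Automorphic.isCompact_glFiniteIntegralLevel n K), 0 < n → ∀ (π : Literature.NumberTheory.Automorphic.CuspidalAutomorphicRepData n K hcpt), π.1.IsLAlgebraic → ¬ (NumberField.IsTotallyReal K ∧ n = 2 ∧ ∃ (k : (K →+* ℂ) → ℕ) (w : ℤ), π.1.HasInfinityType (fun β : K →+* ℂ => ({(⟨((k β : ℂ) - 1 - w) / 2, (1 - (k β : ℂ) - w) / 2, (k β : ℤ) - 1, by push_cast; ring⟩ : Literature.NumberTheory.Automorphic.ArchWeight), (⟨((k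 β : ℂ) - 1 - w) / 2, (1 - (k β : ℂ) - w) / 2, (k β : ℤ) - 1, by push_cast; ring⟩ : Literature.NumberTheory.Automorphic.ArchWeight).swap} : Multiset Literature.NumberTheory.Automorphic.ArchWeight)) ∧ (∀ (u : NumberField.InfinitePlace K), ∀ φ ∈ π.1.W, Literature.NumberTheory.Automorphic.rightTranslation (Literature.NumberTheory.Automorphic.AdelicGroupData.gl n K) (Matrix.GeneralLinearGroup.scalar (Fin n) (Units.map (MonoidHom.inl (NumberField.InfiniteAdeleRing K) (IsDedekindDomain.FiniteAdeleRing (NumberField.RingOfIntegers K) K) : NumberField.InfiniteAdeleRing K →* NumberField.AdeleRing (NumberField.RingOfIntegers K) K) (Units.map (MonoidHom.mulSingle (fun u' : NumberField.InfinitePlace K => u'.Completion) u : u.Completion →* NumberField.InfiniteAdeleRing K) (-1)))) φ + φ ∈ π.1.W')) → ∀ (ℓ : ℕ) [Fact ℓ.Prime] (ι : PadicAlgCl ℓ ≃+* ℂ), (∃ ρ : Literature.NumberTheory.GaloisRepresentations.FramedGaloisRep K (PadicAlgCl ℓ) n, ρ.toGaloisRep.IsIrreducible ∧ Summit.Langlands.IsGeometricFramed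 Rec ρ ∧ ∀ᶠ v : IsDedekindDomain.HeightOneSpectrum (NumberField.RingOfIntegers K) in Filter.cofinite, Summit.Langlands.SatakeFrobCompatibleAt ι π.1 ρ v) ∧ ∀ ρ : Literature.NumberTheory.GaloisRepresentations.FramedGaloisRep K (PadicAlgCl ℓ) n, ρ.toGaloisRep.IsIrreducible → Summit.Langlands.IsGeometricFramed Rec ρ → (∀ᶠ v : IsDedekindDomain.HeightOneSpectrum (NumberField.RingOfIntegers K) in Filter.cofinite, Summit.Langlands.SatakeFrobCompatibleAt ι π.1 ρ v) → (∀ v : IsDedekindDomain.HeightOneSpectrum (NumberField.RingOfIntegers K), Summit.Langlands.LocalGlobalCompatibleAt Rec ι π.1 ρ v) ∧ ∀ ρ' : Literature.NumberTheory.GaloisRepresentations.FramedGaloisRep K (PadicAlgCl ℓ) n, (∀ᶠ v : IsDedekindDomain.HeightOneSpectrum (NumberField.RingOfIntegers K) in Filter.cofinite, Summit.Langlands.SatakeFrobCompatibleAt ι π.1 ρ' v) → Summit.Langlands.IsConjugate ρ ρ'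

end Summit.Langlands.Langlands.Theses.SenNullAlignment

namespace Summit.Langlands.Langlands.Cruxes.OffPlaneReciprocityA.Birth

open scoped MatrixGroups Matrix Classical Polynomial NumberField BigOperators Topology
open Filter IsDedekindDomain
open Literature.NumberTheory.Automorphic Literature.NumberTheory.GaloisRepresentations
open Summit.Langlands
open Summit.Langlands.Langlands.Theses.SenNullAlignment (OffPlaneReciprocityA)

/-! ## 1. The stubs (the ONLY sorries of this file) -/

/-- **stub W⁺_off — an irreducible pinned-geometric avatar exists off the odd-Hilbert plane** (Buzzard–Gee
Conj. 3.2.2 weak form with irreducibility; OPEN off the regular-algebraic-over-CM/TR regime). Rec-free.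
[cite: BuzzardGeeLMS2014, Conj. 3.2.2] [cite: HarrisLanTaylorThorneRMS2016, Thm. A] -/
theorem stub_offPlaneAvatar : ∀ (K : Type) [Field K] [NumberField K] (n : ℕ) (hcpt : Literature.NumberTheory.Automorphic.isCompact_glFiniteIntegralLevel n K), 0 < n → ∀ (π : Literature.NumberTheory.Automorphic.CuspidalAutomorphicRepData n K hcpt), π.1.IsLAlgebraic → ¬ (NumberField.IsTotallyReal K ∧ n = 2 ∧ ∃ (k : (K →+* ℂ) → ℕ) (w : ℤ), π.1.HasInfinityType (fun β : K →+* ℂ => ({(⟨((k β : ℂ) - 1 - w) / 2, (1 - (k β : ℂ) - w) / 2, (k β : ℤ) - 1, by push_cast; ring⟩ : Literature.NumberTheory.Automorphic.ArchWeight), (⟨((k β : ℂ) - 1 - w) / 2, (1 - (k β : ℂ) - w) / 2, (k β : ℤ) - 1, by push_cast; ring⟩ : Literature.NumberTheory.Automorphic.ArchWeight).swap} : Multiset Literature.NumberTheory.Automorphic.ArchWeight)) ∧ (∀ (u : NumberField.InfinitePlace K), ∀ φ ∈ π.1.W, Literature.NumberTheory.Automorphic.rightTranslation (Literature.NumberTheory.Automorphic.AdelicGroupData.gl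 n K) (Matrix.GeneralLinearGroup.scalar (Fin n) (Units.map (MonoidHom.inl (NumberField.InfiniteAdeleRing K) (IsDedekindDomain.FiniteAdeleRing (NumberField.RingOfIntegers K) K) : NumberField.InfiniteAdeleRing K →* NumberField.AdeleRing (NumberField.RingOfIntegers K) K) (Units.map (MonoidHom.mulSingle (fun u' : NumberField.InfinitePlace K => u'.Completion) u : u.Completion →* NumberField.InfiniteAdeleRing K) (-1)))) φ + φ ∈ π.1.W')) → ∀ (ℓ : ℕ) [Fact ℓ.Prime] (ι : PadicAlgCl ℓ ≃+* ℂ), ∃ ρ : Literature.NumberTheory.GaloisRepresentations.FramedGaloisRep K (PadicAlgCl ℓ) n, ρ.toGaloisRep.IsIrreducible ∧ ((∀ᶠ v : IsDedekindDomain.HeightOneSpectrum (NumberField.RingOfIntegers K) in Filter.cofinite, ρ.IsUnramifiedAt v) ∧ ∀ (v : IsDedekindDomain.HeightOneSpectrum (NumberField.RingOfIntegers K)) (hv : ((ℓ : ℕ) : NumberField.RingOfIntegers K) ∈ v.asIdeal), (Literature.NumberTheory.PAdicHodge.fontainePstAdicCompletion v ℓ hv).IsDeRhamFramed (ρ.toLocal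 v)) ∧ ∀ᶠ v : IsDedekindDomain.HeightOneSpectrum (NumberField.RingOfIntegers K) in Filter.cofinite, Summit.Langlands.SatakeFrobCompatibleAt ι π.1 ρ v := by
  sorry

/-- **stub LGC_off — local–global compatibility of irreducible geometric Satake-compatible pairs off the plane,
for every pinned datum** (Taylor 2004 Conj. 7 at every finite place; OPEN in general).
[cite: TaylorGaloisRepresentations2004, Conj. 7] [cite: HarrisTaylorAMS2001, Thm. A] [cite: VarmaFMS2024, Thm. 1] -/
theorem stub_offPlanePairCompatibility : ∀ (K : Type) [Field K] [NumberField K] (Rec : Summit.Langlands.ReciprocityData K) (n : ℕ) (hcpt : Literature.NumberTheory.Automorphic.isCompact_glFiniteIntegralLevel n K), 0 < n → ∀ (π : Literature.NumberTheory.Automorphic.CuspidalAutomorphicRepData n K hcpt), π.1.IsLAlgebraic → ¬ (NumberField.IsTotallyReal K ∧ n = 2 ∧ ∃ (k : (K →+* ℂ) → ℕ) (w : ℤ), π.1.HasInfinityType (fun β : K →+* ℂ => ({(⟨((k β : ℂ) - 1 - w) / 2, (1 - (k β : ℂ) - w) / 2, (k β : ℤ) - 1, by push_cast; ring⟩ :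 Literature.NumberTheory.Automorphic.ArchWeight), (⟨((k β : ℂ) - 1 - w) / 2, (1 - (k β : ℂ) - w) / 2, (k β : ℤ) - 1, by push_cast; ring⟩ : Literature.NumberTheory.Automorphic.ArchWeight).swap} : Multiset Literature.NumberTheory.Automorphic.ArchWeight)) ∧ (∀ (u : NumberField.InfinitePlace K), ∀ φ ∈ π.1.W, Literature.NumberTheory.Automorphic.rightTranslation (Literature.NumberTheory.Automorphic.AdelicGroupData.gl n K) (Matrix.GeneralLinearGroup.scalar (Fin n) (Units.map (MonoidHom.inl (NumberField.InfiniteAdeleRing K) (IsDedekindDomain.FiniteAdeleRing (NumberField.RingOfIntegers K) K) : NumberField.InfiniteAdeleRing K →* NumberField.AdeleRing (NumberField.RingOfIntegers K) K) (Units.map (MonoidHom.mulSingle (fun u' : NumberField.InfinitePlace K => u'.Completion) u : u.Completion →* NumberField.InfiniteAdeleRing K) (-1)))) φ + φ ∈ π.1.W')) → ∀ (ℓ : ℕ) [Fact ℓ.Prime] (ι : PadicAlgCl ℓ ≃+* ℂ) (ρ : Literature.NumberTheory.GaloisRepresentations.FramedGaloisRep K (PadicAlgCl ℓ) n), ρ.toGaloisRep.IsIrreducible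 → Summit.Langlands.IsGeometricFramed Rec ρ → (∀ᶠ v : IsDedekindDomain.HeightOneSpectrum (NumberField.RingOfIntegers K) in Filter.cofinite, Summit.Langlands.SatakeFrobCompatibleAt ι π.1 ρ v) → ∀ v : IsDedekindDomain.HeightOneSpectrum (NumberField.RingOfIntegers K), Summit.Langlands.LocalGlobalCompatibleAt Rec ι π.1 ρ v := by
  sorry

/-- **stub U — uniqueness of the irreducible Satake avatar up to conjugacy** (a theorem: Chebotarev + Brauer–Nesbitt;
VERBATIM item stmt-Langlands-17844 `PrimeSwitchSplit.AvatarConjugacy`). [cite: DeligneSerreASENS1974, Lemme 3.2] -/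
theorem stub_avatarConjugacy : ∀ (K : Type) [Field K] [NumberField K] (n : ℕ) (hcpt : Literature.NumberTheory.Automorphic.isCompact_glFiniteIntegralLevel n K) (π : Literature.NumberTheory.Automorphic.CuspidalAutomorphicRepData n K hcpt) (ℓ : ℕ) [Fact ℓ.Prime] (ι : PadicAlgCl ℓ ≃+* ℂ) (ρ₀ ρ : Literature.NumberTheory.GaloisRepresentations.FramedGaloisRep K (PadicAlgCl ℓ) n), ρ₀.toGaloisRep.IsIrreducible → (∀ᶠ v : IsDedekindDomain.HeightOneSpectrum (NumberField.RingOfIntegers K) in Filter.cofinite, Summit.Langlands.SatakeFrobCompatibleAt ι π.1 ρ₀ v) → (∀ᶠ v : IsDedekindDomain.HeightOneSpectrum (NumberField.RingOfIntegers K) in Filter.cofinite, Summit.Langlands.SatakeFrobCompatibleAt ι π.1 ρ v) → Summit.Langlands.IsConjugate ρ₀ ρ := by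
  sorry

/-! ## 2. The stub statements as named propositions -/

namespace _Goal

/-- The statement of `stub_offPlaneAvatar` (literally its type). [folklore] -/
def stub_offPlaneAvatar : Prop :=
  type_of% @Summit.Langlands.Langlands.Cruxes.OffPlaneReciprocityA.Birth.stub_offPlaneAvatar

/-- The statement of `stub_offPlanePairCompatibility` (literally its type). [folklore] -/
def stub_offPlanePairCompatibility : Prop :=
  type_of% @Summit.Langlands.Langlands.Cruxes.OffPlaneReciprocityA.Birth.stub_offPlanePairCompatibility

/-- The statement of `stub_avatarConjugacy` (literally its type). [folklore] -/
def stub_avatarConjugacy : Prop :=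
  type_of% @Summit.Langlands.Langlands.Cruxes.OffPlaneReciprocityA.Birth.stub_avatarConjugacy

end _Goal

/-! ## 3. The composition (kernel-checked, no `sorry`) -/

/-- **`OffPlaneReciprocityA` from its three stubs**: existence half = W⁺_off (its pinned-geometricity IS
`IsGeometricFramed Rec` by `rfl`, `ReciprocityData.pst` ignoring its datum); pair half = LGC_off and U. -/
theorem OffPlaneReciprocityA_of (hW : _Goal.stub_offPlaneAvatar) (hL : _Goal.stub_offPlanePairCompatibility)
    (hU : _Goal.stub_avatarConjugacy) : OffPlaneReciprocityA := by
  dsimp only [_Goal.stub_offPlaneAvatar, _Goal.stub_offPlanePairCompatibility, _Goal.stub_avatarConjugacy] at hW hL hU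
  intro K _ _ Rec n hcpt hn π hLalg hoff ℓ _ ι
  refine ⟨?_, fun ρ hirr hgeo hsat => ⟨hL K Rec n hcpt hn π hLalg hoff ℓ ι ρ hirr hgeo hsat, fun ρ' hsat' => hU K n hcpt π ℓ ι ρ ρ' hirr hsat hsat'⟩⟩
  obtain ⟨ρ, hirr, hgeo, hsat⟩ := hW K n hcpt hn π hLalg hoff ℓ ι
  exact ⟨ρ, hirr, hgeo, hsat⟩

/-- By-name sanity check: the stubs feed the composition as they stand. -/
example : OffPlaneReciprocityA :=
  OffPlaneReciprocityA_of stub_offPlaneAvatar stub_offPlanePairCompatibility stub_avatarConjugacy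

end Summit.Langlands.Langlands.Cruxes.OffPlaneReciprocityA.Birth

end
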